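import Literature.Probability.LatticeModels.PlaneRotatorLiebBoxCriterion
import Literature.Probability.LatticeModels.PlaneRotatorPathFloor
import Literature.MathematicalPhysics.QuantumLattice.LatticeToriProofs
import Literature.Probability.LatticeModels.GaussianDomination
import HarnessLib

/-!
# Lieb's box criterion transported to the torus: `⟨cos(θ_a − θ_c)⟩_{K,L} ≤ S_R(K)^{⌊dist_∞(a,c)/R⌋}` on
# `(ℤ/Lℤ)^d` for every `L ≥ 2R + 2`

Topic `Literature/Probability/LatticeModels`. E. H. Lieb, Comm. Math. Phys. **77** (1980) 127, Theorem 4 and p. 128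
(boxes: "a finite algorithm to compute the transition temperature to arbitrary accuracy") with B. Simon, ibid. 111,
Thm 1.3 [Lieb1980] [Simon1980CMP] [Rivasseau1980]. The tree holds the box criterion for every finite `Λ ⊂ ℤ^ν` with
free boundary conditions (`PlaneRotator.twoPoint_le_pow_boxShellSum`, `PlaneRotatorLiebBoxCriterion.lean`; Lieb's
number `S_R = boxShellSum`, `nnBoxShellSum K ν R` for the nearest-neighbour model) and its abstract half on an
arbitrary finite vertex set (`twoPoint_le_pow_of_shell_rowSum_le`, `twoPoint_le_of_injOn`, `PlaneRotatorShellDecay.lean`).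
This file is the PERIODIC instance: the nearest-neighbour plane rotator `torusXY d L` on `(ℤ/Lℤ)^d`
(`BondSystem.expectJ`, uniform coupling `K`).

* §1 The symmetrised pair coupling of the torus (`torusXY_pairCoupling_apply`,
  `torusXY_symmCoupling_pairCoupling`): `K/2` on torus-adjacent ordered pairs, `0` elsewhere (`L ≥ 3`); a non-zero
  coupling joins sites at torus distance `≤ 1`.
* §2 **Box coordinates.** For `L ≥ 2R + 2` the torus box `{y : dist_∞(y, x) ≤ R}` embeds into the reference box
  `[−R, R]^d ⊂ ℤ^d` by the balanced representatives `y ↦ (valMinAbs (y − x)ᵢ)ᵢ` (written inline), isometrically for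
  the sup norms (`supNorm_torusBoxCoord`) and taking torus-adjacent pairs of the box to nearest neighbours of `ℤ^d`
  (`torusBoxCoord_add_single`: no wrap-around inside a box of diameter `2R + 1 < L`).
* §3 **The criterion** (`torusXY_expectJ_cosDiff_le_pow_nnBoxShellSum`): for `d ≥ 1`, `R ≥ 1`, `L ≥ 2R + 2`, `K ≥ 0`
  and all `a, c`: `⟨cos(θ_a − θ_c)⟩_{K,L} ≤ S_R(K)^{⌊dist_∞(a,c)/R⌋}`, `S_R(K) = nnBoxShellSum K d R` — the SAME number as
  for the free boxes (the inside system of a torus box is dominated by, in fact isomorphic to, Lieb's reference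
  system), so `S_R(K) < 1` for ONE radius certifies exponential decay of the torus two-point function uniformly in the
  volume `L ≥ 2R + 2`. `R = 1` is Lieb's star `2d·u(K)` (`PlaneRotatorStiffnessHighTemperatureLieb.lean` §7 for `d = 2`).

Cell use (`pub/hubbard-tc`, MO-S3, crux №2 classical side): the decay input for the helicity-modulus bound
`|βΥ_L| ≤ 4K²L²·B²` beyond Lieb's star (`PlaneRotatorStiffnessBoxCriterion.lean`).

## What this is not

A classical comparison-model statement; no number is asserted about `S_R(K)` (the certified enclosures
`S_2(0.663) < 1 < S_2(0.664)` live in the cell's K5-LIEB-BOX-R2 sheet, not in the kernel); nothing electronic.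
-/

noncomputable section

open MeasureTheory Finset
open scoped BigOperators

namespace Literature.Probability.LatticeModels

open PlaneRotator Literature.Barriers.CriticalPhenomena Literature.Barriers.CriticalPhenomena.LongRangeIsing
open Literature.MathematicalPhysics.QuantumLattice

variable {d L : ℕ} [NeZero L]

/-! ## §1 The symmetrised pair coupling of the torus -/

section Coupling

/-- **The fibre-summed pair coupling of `torusXY d L`** at uniform coupling `K`: `J(x, y) = K·ν(x, y)`,
`ν(x, y) = #{i : x + eᵢ = y}`. [cite: Lieb1980, Theorem 4 (nearest-neighbour rotators on a hypercubic lattice)] -/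
theorem torusXY_pairCoupling_apply (K : ℝ) (x y : TorusSite d L) :
    (torusXY d L).pairCoupling (fun _ => K) (x, y) =
      K * ∑ i : Fin d, if x + Pi.single i 1 = y then (1 : ℝ) else 0 := by
  unfold BondSystem.pairCoupling
  rw [Finset.sum_filter, Fintype.sum_prod_type, Finset.mul_sum]
  have hst : ∀ (z : TorusSite d L) (i : Fin d), ((torusXY d L).src (z, i), (torusXY d L).tgt (z, i)) =
      (z, z + Pi.single i 1) := fun z i => rfl
  simp only [hst, Prod.mk.injEq]
  rw [Finset.sum_comm]
  refine Finset.sum_congr rfl fun i _ => ?_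
  rw [show (∑ z : TorusSite d L, if z = x ∧ z + Pi.single i 1 = y then K else 0) =
      ∑ z : TorusSite d L, if z = x then (if x + Pi.single i 1 = y then K else 0) else 0 from
    Finset.sum_congr rfl fun z _ => by
      by_cases hz : z = x
      · subst hz; simp
      · simp [hz]]
  rw [Finset.sum_ite_eq' Finset.univ x, if_pos (Finset.mem_univ x)]
  split_ifs <;> simp

omit [NeZero L] in
/-- `ν(x, y) ≥ 0`. [cite: Lieb1980, Theorem 4 — plumbing] -/
theorem torusXY_nbr_nonneg (x y : TorusSite d L) :
    0 ≤ ∑ i : Fin d, if x + Pi.single i 1 = y then (1 : ℝ) else 0 :=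
  Finset.sum_nonneg fun i _ => by split_ifs <;> norm_num

omit [NeZero L] in
/-- `ν(x, y) ∈ {0, 1}` for `L ≥ 2`. [cite: Lieb1980, Theorem 4 — plumbing] -/
theorem torusXY_nbr_eq_zero_or_one (hL : 2 ≤ L) (x y : TorusSite d L) :
    (∑ i : Fin d, if x + Pi.single i 1 = y then (1 : ℝ) else 0) = 0 ∨
      (∑ i : Fin d, if x + Pi.single i 1 = y then (1 : ℝ) else 0) = 1 := by
  classical
  by_cases h : ∃ i : Fin d, x + Pi.single i 1 = y
  · obtain ⟨i, hi⟩ := h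
    right
    rw [Finset.sum_eq_single i (fun j _ hj => ?_) (fun hi' => absurd (Finset.mem_univ i) hi'), if_pos hi]
    rw [if_neg]
    intro hj'
    exact hj (torus_single_injective hL (add_left_cancel (hj'.trans hi.symm)))
  · left
    exact Finset.sum_eq_zero fun i _ => if_neg fun hi => h ⟨i, hi⟩

omit [NeZero L] in
/-- `ν(x, y) + ν(y, x) ≤ 1` for `L ≥ 3`: a pair of sites is joined by at most one bond of `torusXY d L`.
[cite: Lieb1980, Theorem 4 — plumbing] -/
theorem torusXY_nbr_add_nbr_le_one (hL : 3 ≤ L) (x y : TorusSite d L) :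
    (∑ i : Fin d, if x + Pi.single i 1 = y then (1 : ℝ) else 0) +
        (∑ i : Fin d, if y + Pi.single i 1 = x then (1 : ℝ) else 0) ≤ 1 := by
  rcases torusXY_nbr_eq_zero_or_one (by omega) x y with hx | hx <;>
    rcases torusXY_nbr_eq_zero_or_one (by omega) y x with hy | hy <;> rw [hx, hy] <;> norm_num
  -- both `1`: `y = x + eᵢ` and `x = y + eᵢ'` force `eᵢ + eᵢ' = 0`
  classical
  have hx' : ∃ i : Fin d, x + Pi.single i 1 = y := by
    by_contra h
    have : (∑ i : Fin d, if x + Pi.single i 1 = y then (1 : ℝ) else 0) = 0 :=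
      Finset.sum_eq_zero fun i _ => if_neg fun hi => h ⟨i, hi⟩
    rw [this] at hx; exact one_ne_zero hx.symm
  have hy' : ∃ i : Fin d, y + Pi.single i 1 = x := by
    by_contra h
    have : (∑ i : Fin d, if y + Pi.single i 1 = x then (1 : ℝ) else 0) = 0 :=
      Finset.sum_eq_zero fun i _ => if_neg fun hi => h ⟨i, hi⟩
    rw [this] at hy; exact one_ne_zero hy.symm
  obtain ⟨i, hi⟩ := hx'
  obtain ⟨i', hi'⟩ := hy'
  exfalso
  refine torus_single_add_single_ne_zero hL i i' ?_
  have h := hi'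
  rw [← hi, add_assoc] at h
  exact add_left_cancel (h.trans (add_zero x).symm)

/-- **The symmetrised torus coupling**: `(J(x,y) + J(y,x))/2 = (K/2)·(ν(x,y) + ν(y,x))` — `K/2` on torus-adjacent
ordered pairs, `0` elsewhere (for `L ≥ 3`). [cite: Lieb1980, Theorem 4 (nearest-neighbour rotators)] -/
theorem torusXY_symmCoupling_pairCoupling (K : ℝ) (x y : TorusSite d L) :
    symmCoupling ((torusXY d L).pairCoupling fun _ => K) (x, y) =
      K / 2 * ((∑ i : Fin d, if x + Pi.single i 1 = y then (1 : ℝ) else 0) +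
        ∑ i : Fin d, if y + Pi.single i 1 = x then (1 : ℝ) else 0) := by
  rw [symmCoupling]
  dsimp only [Prod.swap_prod_mk]
  rw [torusXY_pairCoupling_apply, torusXY_pairCoupling_apply]
  ring

/-- The symmetrised torus coupling is non-negative for `K ≥ 0`. [cite: Lieb1980, Theorem 4 — plumbing] -/
theorem torusXY_symmCoupling_nonneg {K : ℝ} (hK : 0 ≤ K) (p : TorusSite d L × TorusSite d L) :
    0 ≤ symmCoupling ((torusXY d L).pairCoupling fun _ => K) p :=
  symmCoupling_nonneg ((torusXY d L).pairCoupling_nonneg fun _ => hK) p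

/-- The unit vectors have torus norm `≤ 1`. [cite: FriedliVelenik2017, §3.1 (torus metric) — plumbing] -/
theorem torusNorm_single_le_one (i : Fin d) :
    torusNorm (Ls := fun _ : Fin d => L) (Pi.single i (1 : ZMod L)) ≤ 1 := by
  simp only [torusNorm]
  refine Finset.sup_le fun j _ => ?_
  rcases eq_or_ne j i with rfl | hj
  · rw [Pi.single_eq_same]; exact cyclicAbs_one_le
  · rw [Pi.single_eq_of_ne hj, ZMod.val_zero]; simp

/-- Torus-adjacent sites are at torus distance `≤ 1`: `dist_∞(x, x + eᵢ) ≤ 1`. [cite: FriedliVelenik2017, §3.1 (torus metric) — plumbing] -/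
theorem torusDist_add_single_le_one (x : TorusSite d L) (i : Fin d) :
    torusDist x (x + Pi.single i 1) ≤ 1 := by
  rw [torusDist, show x - (x + Pi.single i 1) = -(Pi.single i 1 : TorusSite d L) by abel, torusNorm_neg]
  exact torusNorm_single_le_one i

/-- A non-zero symmetrised coupling joins sites at torus distance `≤ 1`. [cite: Lieb1980, Theorem 4 (nearest-neighbour range)] -/
theorem torusDist_le_one_of_symmCoupling_ne_zero {K : ℝ} {x y : TorusSite d L}
    (h : symmCoupling ((torusXY d L).pairCoupling fun _ => K) (x, y) ≠ 0) : torusDist x y ≤ 1 := by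
  rw [torusXY_symmCoupling_pairCoupling] at h
  have hsum : (∑ i : Fin d, if x + Pi.single i 1 = y then (1 : ℝ) else 0) +
      (∑ i : Fin d, if y + Pi.single i 1 = x then (1 : ℝ) else 0) ≠ 0 := fun h0 => h (by rw [h0, mul_zero])
  by_cases hx : (∑ i : Fin d, if x + Pi.single i 1 = y then (1 : ℝ) else 0) = 0
  · rw [hx, zero_add] at hsum
    obtain ⟨i, -, hi⟩ := Finset.exists_ne_zero_of_sum_ne_zero hsum
    have hi' : y + Pi.single i 1 = x := by by_contra hc; exact hi (if_neg hc)
    rw [← hi', torusDist_comm']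
    exact torusDist_add_single_le_one y i
  · obtain ⟨i, -, hi⟩ := Finset.exists_ne_zero_of_sum_ne_zero hx
    have hi' : x + Pi.single i 1 = y := by by_contra hc; exact hi (if_neg hc)
    rw [← hi']
    exact torusDist_add_single_le_one x i

end Coupling

/-! ## §2 Box coordinates: the torus box of radius `R` embeds into `[−R, R]^d` for `L ≥ 2R + 2` -/

section Coord

omit [NeZero L] in
/-- The **box coordinates** of `y` around `x` — the balanced representatives `(valMinAbs (y − x)ᵢ)ᵢ ∈ ℤ^d`, written
inline as `fun i => ((y - x) i).valMinAbs` — vanish at `y = x`. [cite: Lieb1980, p. 128 (B the boundary of a box) — the torus box read in ℤ^d] -/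
theorem torusBoxCoord_self (x : TorusSite d L) : (fun i => ((x - x) i).valMinAbs : Site d) = 0 := by
  funext i; simp

/-- **The box coordinates are isometric for the sup norms**: `‖coord_x(y)‖_∞ = dist_∞(y, x)`
(`|valMinAbs a| = min(a.val, L − a.val)`, Mathlib `ZMod.valMinAbs_natAbs_eq_min`). [cite: FriedliVelenik2017, §3.1 (periodic sup norm)] -/
theorem supNorm_torusBoxCoord (x y : TorusSite d L) :
    Site.supNorm (fun i => ((y - x) i).valMinAbs : Site d) = torusDist y x := by
  unfold Site.supNorm torusDist torusNorm
  exact Finset.sup_congr rfl fun i _ => ZMod.valMinAbs_natAbs_eq_min _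

omit [NeZero L] in
/-- The box coordinates are injective in `y` (balanced representatives determine the residues).
[cite: Lieb1980, p. 128 — plumbing] -/
theorem torusBoxCoord_injective (x : TorusSite d L) :
    Function.Injective fun y : TorusSite d L => (fun i => ((y - x) i).valMinAbs : Site d) := by
  intro y z h
  have hyz : y - x = z - x := funext fun i => by
    have hi := congrFun h i
    dsimp only at hi
    rw [← ZMod.coe_valMinAbs ((y - x) i), ← ZMod.coe_valMinAbs ((z - x) i), hi]
  exact sub_left_injective hyz

omit [NeZero L] in
/-- Two integers with the same residue mod `L` at distance `< L` are equal. [cite: FriedliVelenik2017, §3.1 — plumbing] -/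
theorem int_eq_of_cast_eq_of_natAbs_lt {u v : ℤ} (h : (u : ZMod L) = (v : ZMod L)) (hlt : (u - v).natAbs < L) :
    u = v := by
  have hdvd : (L : ℤ) ∣ u - v := (ZMod.intCast_eq_intCast_iff_dvd_sub v u L).1 h.symm
  have h0 : u - v = 0 := Int.eq_zero_of_dvd_of_natAbs_lt_natAbs hdvd (by simpa using hlt)
  omega

omit [NeZero L] in
/-- **No wrap-around inside a box of diameter `2R + 1 < L`**: if `|valMinAbs a| ≤ R` and `|valMinAbs (a + 1)| ≤ R` with
`L ≥ 2R + 2`, then `valMinAbs (a + 1) = valMinAbs a + 1`. [cite: FriedliVelenik2017, §3.1 — plumbing] -/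
theorem valMinAbs_add_one_of_le {R : ℕ} (hL : 2 * R + 2 ≤ L) {a : ZMod L} (ha : a.valMinAbs.natAbs ≤ R)
    (ha1 : (a + 1).valMinAbs.natAbs ≤ R) : (a + 1).valMinAbs = a.valMinAbs + 1 := by
  refine int_eq_of_cast_eq_of_natAbs_lt (L := L) ?_ ?_
  · rw [ZMod.coe_valMinAbs, Int.cast_add, ZMod.coe_valMinAbs, Int.cast_one]
  · have h1 : ((a + 1).valMinAbs - (a.valMinAbs + 1)).natAbs ≤ (a + 1).valMinAbs.natAbs + (a.valMinAbs + 1).natAbs :=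
      Int.natAbs_sub_le _ _
    have h2 : (a.valMinAbs + 1).natAbs ≤ a.valMinAbs.natAbs + 1 := by
      have := Int.natAbs_add_le a.valMinAbs 1
      simpa using this
    omega

/-- **Torus-adjacent pairs inside the box are nearest neighbours in box coordinates**: for `L ≥ 2R + 2`, if
`dist_∞(y, x) ≤ R` and `dist_∞(y + eᵢ, x) ≤ R` then `coord_x(y + eᵢ) = coord_x(y) + eᵢ`. [cite: Lieb1980, p. 128 (the box as inside system) — transport to the torus] -/
theorem torusBoxCoord_add_single {R : ℕ} (hL : 2 * R + 2 ≤ L) {x y : TorusSite d L} (i : Fin d)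
    (hy : torusDist y x ≤ R) (hy' : torusDist (y + Pi.single i 1) x ≤ R) :
    (fun j => ((y + Pi.single i 1 - x : TorusSite d L) j).valMinAbs : Site d) =
      (fun j => ((y - x) j).valMinAbs : Site d) + Pi.single i (1 : ℤ) := by
  rw [← supNorm_torusBoxCoord, Site.supNorm_le_iff] at hy hy'
  funext j
  rcases eq_or_ne j i with rfl | hj
  · have e : ((y + Pi.single j 1 - x : TorusSite d L) j) = (y - x) j + 1 := by
      simp only [Pi.sub_apply, Pi.add_apply, Pi.single_eq_same]; ring
    have hyj := hy j
    have hy'j := hy' j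
    rw [e] at hy'j
    show ((y + Pi.single j 1 - x : TorusSite d L) j).valMinAbs = ((y - x) j).valMinAbs + (Pi.single j (1 : ℤ) : Site d) j
    rw [Pi.single_eq_same, e]
    exact valMinAbs_add_one_of_le hL hyj hy'j
  · simp only [Pi.add_apply, Pi.sub_apply, Pi.single_eq_of_ne hj, add_zero]

/-- Hence `‖coord_x(y) − coord_x(y + eᵢ)‖₁ = 1` for such pairs. [cite: Lieb1980, p. 128 — transport to the torus] -/
theorem l1Norm_torusBoxCoord_sub_of_add_single {R : ℕ} (hL : 2 * R + 2 ≤ L) {x y : TorusSite d L} (i : Fin d)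
    (hy : torusDist y x ≤ R) (hy' : torusDist (y + Pi.single i 1) x ≤ R) :
    l1Norm ((fun j => ((y - x) j).valMinAbs : Site d) - (fun j => ((y + Pi.single i 1 - x : TorusSite d L) j).valMinAbs : Site d)) = 1 := by
  rw [torusBoxCoord_add_single hL i hy hy', sub_add_cancel_left, l1Norm_neg]
  exact l1Norm_single i

end Coord

/-! ## §3 The box criterion on the torus -/

section Criterion

variable [MeasurableSpace Circle] [BorelSpace Circle]

/-- **Lieb's box criterion on the torus `(ℤ/Lℤ)^d`.** For `R ≥ 1`, `L ≥ 2R + 2`, `K ≥ 0` and all sites `a, c`: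

  `⟨cos(θ_a − θ_c)⟩_{K,L} ≤ S_R(K)^{⌊dist_∞(a,c)/R⌋}`,  `S_R(K) = nnBoxShellSum K d R`

— Lieb's number of the FREE reference box `[−R, R]^d` (shell–shell bonds removed). Proof: Lieb's separating inequality
(23) with the torus box `A_x = {dist_∞(·, x) ≤ R}` and its shell `S_x = {dist_∞(·, x) = R}` as inside system
(nearest-neighbour range: every bond leaving `A_x` starts on `S_x`); in box coordinates (§2) the inside system embeds
into the reference system (Griffiths–Ginibre comparison `twoPoint_le_of_injOn`), so every shell row sum is `≤ S_R(K)`;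
Simon's iteration with `d = ⌊dist_∞(·, c)/R⌋` (`twoPoint_le_pow_of_shell_rowSum_le`). Hence `S_R(K) < 1` for ONE `R`
gives exponential decay of the torus two-point function with the same rate in every volume `L ≥ 2R + 2`.
[cite: Lieb1980, eq. (23), Theorem 4 and p. 128 (boxes; finite algorithm); Simon1980CMP, Thm 1.3] -/
theorem torusXY_expectJ_cosDiff_le_pow_nnBoxShellSum {R : ℕ} (hR : 1 ≤ R) (hL : 2 * R + 2 ≤ L) {K : ℝ} (hK : 0 ≤ K)
    (a c : TorusSite d L) :
    (torusXY d L).expectJ (fun _ => K) (cosDiff a c) ≤ nnBoxShellSum K d R ^ (torusDist a c / R) := by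
  classical
  have hR0 : 0 < R := hR
  have hL3 : 3 ≤ L := by omega
  -- the symmetrised pair coupling
  set J : TorusSite d L × TorusSite d L → ℝ := symmCoupling ((torusXY d L).pairCoupling fun _ => K) with hJdef
  have hJ0 : ∀ p, 0 ≤ J p := torusXY_symmCoupling_nonneg hK
  rw [(torusXY d L).expectJ_cosDiff_eq_twoPoint, ← twoPoint_symmCoupling]
  -- the reference data
  set Jf : Site d → Site d → ℝ := fun u v => K / 2 * nnCoupling d u v with hJf
  have hJf0 : ∀ u v, 0 ≤ Jf u v := fun u v => mul_nonneg (div_nonneg hK zero_le_two) (nnCoupling_nonneg _ _)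
  -- boxes and shells on the torus
  set A : TorusSite d L → Finset (TorusSite d L) := fun x => Finset.univ.filter fun y => torusDist y x ≤ R with hAdef
  set S : TorusSite d L → Finset (TorusSite d L) := fun x => Finset.univ.filter fun y => torusDist y x = R with hSdef
  have memA : ∀ x y, y ∈ A x ↔ torusDist y x ≤ R := fun x y => by simp [hAdef]
  have memS : ∀ x y, y ∈ S x ↔ torusDist y x = R := fun x y => by simp [hSdef]
  have hxA : ∀ x, x ∈ A x := fun x => by rw [memA, torusDist_self]; exact Nat.zero_le _
  refine twoPoint_le_pow_of_shell_rowSum_le hJ0 A S (fun x y hy => ?_) hxA (fun x p hp => ?_)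
    (s := nnBoxShellSum K d R) (fun x => ?_) c (d := fun y => torusDist y c / R)
    (fun x hx hcA => ?_) (fun x b hb => ?_) a
  · -- `S x ⊆ A x`
    rw [memA]; rw [memS] at hy; exact hy.le
  · -- every bond leaving the box starts on the shell (range one)
    have h1 : torusDist p.1 p.2 ≤ 1 := torusDist_le_one_of_symmCoupling_ne_zero hp
    constructor
    · intro hin hout
      rw [memA] at hin; rw [memA, not_le] at hout; rw [memS]
      refine le_antisymm hin ?_
      have htri := torusDist_triangle' p.2 p.1 x
      rw [torusDist_comm' p.2 p.1] at htri
      omega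
    · intro hin hout
      rw [memA] at hin; rw [memA, not_le] at hout; rw [memS]
      refine le_antisymm hin ?_
      have htri := torusDist_triangle' p.1 p.2 x
      omega
  · -- the shell row sum of the torus box is at most `S_R(K)`
    let τ : TorusSite d L → box d R := fun y =>
      if h : torusDist y x ≤ R then
        ⟨fun i => ((y - x) i).valMinAbs, mem_box_iff_supNorm_le.2 (by rw [supNorm_torusBoxCoord]; exact h)⟩
      else refCentre d R
    have hτ_val : ∀ y, y ∈ A x → ((τ y : box d R) : Site d) = fun i => ((y - x) i).valMinAbs := fun y hy => by
      rw [memA] at hy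
      simp only [τ, dif_pos hy]
    have hτx : τ x = refCentre d R := by
      apply Subtype.ext
      rw [hτ_val x (hxA x), torusBoxCoord_self]
      rfl
    have hτinj : Set.InjOn τ (A x) := by
      intro y hy z hz hyz
      have h : ((τ y : box d R) : Site d) = ((τ z : box d R) : Site d) := congrArg _ hyz
      rw [hτ_val y hy, hτ_val z hz] at h
      exact torusBoxCoord_injective x h
    have hτS : ∀ b, b ∈ S x → τ b ∈ refShell d R := fun b hb => by
      have hbA : b ∈ A x := by rw [memA]; rw [memS] at hb; exact hb.le
      simp only [refShell, Finset.mem_filter, Finset.mem_univ, true_and]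
      rw [hτ_val b hbA, supNorm_torusBoxCoord]
      exact (memS x b).1 hb
    -- domination of the inside couplings by the reference couplings
    have hdom : ∀ y ∈ A x, ∀ z ∈ A x, insideCoupling J (A x) (S x) (y, z) ≤ refCoupling Jf R (τ y, τ z) := by
      intro y hy z hz
      by_cases hS : y ∈ S x ∧ z ∈ S x
      · rw [insideCoupling_of_shell (A := A x) hS.1 hS.2]
        exact refCoupling_nonneg hJf0 R _
      · rw [insideCoupling_of_mem (p := (y, z)) hy hz hS]
        have hnotshell : ¬(Site.supNorm ((τ y : box d R) : Site d) = R ∧ Site.supNorm ((τ z : box d R) : Site d) = R) := by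
          rw [hτ_val y hy, hτ_val z hz, supNorm_torusBoxCoord, supNorm_torusBoxCoord, ← memS, ← memS]
          exact hS
        show J (y, z) ≤ refCoupling Jf R (τ y, τ z)
        unfold refCoupling
        rw [if_neg hnotshell, hτ_val y hy, hτ_val z hz]
        -- `J(y,z) = (K/2)(ν(y,z) + ν(z,y))`; if non-zero the pair is adjacent and its coordinates are neighbours
        by_cases hJ0' : J (y, z) = 0
        · rw [hJ0']; exact hJf0 _ _
        · have hyA := (memA x y).1 hy
          have hzA := (memA x z).1 hz
          have hadj : nnCoupling d (fun i => ((y - x) i).valMinAbs) (fun i => ((z - x) i).valMinAbs) = 1 := by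
            have hne := hJ0'
            rw [hJdef, torusXY_symmCoupling_pairCoupling] at hne
            have hsum : (∑ i : Fin d, if y + Pi.single i 1 = z then (1 : ℝ) else 0) +
                (∑ i : Fin d, if z + Pi.single i 1 = y then (1 : ℝ) else 0) ≠ 0 := fun h0 => hne (by rw [h0, mul_zero])
            unfold nnCoupling
            rw [if_pos]
            by_cases hy0 : (∑ i : Fin d, if y + Pi.single i 1 = z then (1 : ℝ) else 0) = 0
            · rw [hy0, zero_add] at hsum
              obtain ⟨i, -, hi⟩ := Finset.exists_ne_zero_of_sum_ne_zero hsum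
              have hi' : z + Pi.single i 1 = y := by by_contra hc; exact hi (if_neg hc)
              rw [← hi'] at hyA ⊢
              rw [l1Norm_sub_comm]
              exact l1Norm_torusBoxCoord_sub_of_add_single hL i hzA hyA
            · obtain ⟨i, -, hi⟩ := Finset.exists_ne_zero_of_sum_ne_zero hy0
              have hi' : y + Pi.single i 1 = z := by by_contra hc; exact hi (if_neg hc)
              rw [← hi'] at hzA ⊢
              exact l1Norm_torusBoxCoord_sub_of_add_single hL i hyA hzA
          rw [hJf]
          dsimp only
          rw [hadj, mul_one, hJdef, torusXY_symmCoupling_pairCoupling]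
          have hle := torusXY_nbr_add_nbr_le_one hL3 y z
          calc K / 2 * ((∑ i : Fin d, if y + Pi.single i 1 = z then (1 : ℝ) else 0) +
                ∑ i : Fin d, if z + Pi.single i 1 = y then (1 : ℝ) else 0) ≤ K / 2 * 1 :=
                mul_le_mul_of_nonneg_left hle (div_nonneg hK zero_le_two)
            _ = K / 2 := mul_one _
    calc ∑ b ∈ S x, PlaneRotator.twoPoint (insideCoupling J (A x) (S x)) x b
        ≤ ∑ b ∈ S x, PlaneRotator.twoPoint (refCoupling Jf R) (refCentre d R) (τ b) := by
          refine Finset.sum_le_sum fun b hb => ?_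
          have hbA : b ∈ A x := by rw [memA]; rw [memS] at hb; exact hb.le
          have h := twoPoint_le_of_injOn (insideCoupling_nonneg hJ0 (A x) (S x))
            (insideCoupling_support J (A x) (S x)) τ hτinj (refCoupling_nonneg hJf0 R) hdom (hxA x) hbA
          rwa [hτx] at h
      _ = ∑ b' ∈ (S x).image τ, PlaneRotator.twoPoint (refCoupling Jf R) (refCentre d R) b' := by
          rw [Finset.sum_image]
          intro y hy z hz hyz
          exact hτinj ((memA x y).2 ((memS x y).1 hy).le) ((memA x z).2 ((memS x z).1 hz).le) hyz
      _ ≤ nnBoxShellSum K d R := by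
          refine Finset.sum_le_sum_of_subset_of_nonneg (fun b' hb' => ?_)
            fun b' _ _ => twoPoint_nonneg (refCoupling_nonneg hJf0 R) _ _
          obtain ⟨b, hb, rfl⟩ := Finset.mem_image.1 hb'
          exact hτS b hb
  · -- `d x ≠ 0` forces `c` out of the interior of the box of `x`
    rw [memS]; rw [memA] at hcA
    have hge : R ≤ torusDist x c := by
      by_contra hlt
      exact hx ((Nat.div_eq_zero_iff_lt hR0).2 (not_le.1 hlt))
    rw [torusDist_comm'] at hge
    exact le_antisymm hcA hge
  · -- `d` drops by at most one across a shell: `dist(x, c) ≤ R + dist(b, c)`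
    rw [memS] at hb
    have htri := torusDist_triangle' x b c
    rw [torusDist_comm' x b, hb] at htri
    calc torusDist x c / R ≤ (torusDist b c + R) / R := Nat.div_le_div_right (by omega)
      _ = torusDist b c / R + 1 := Nat.add_div_right _ hR0

/-- The same with the Ginibre floor and in the `expect K 1` vocabulary of the McBryan–Spencer / typing-rule files:
`0 ≤ ⟨cos(θ_a − θ_c)⟩_{K,L} ≤ S_R(K)^{⌊dist_∞(a,c)/R⌋}`. [cite: Lieb1980, Theorem 4 and p. 128 (boxes); Simon1980CMP, Thm 1.3] -/
theorem torusXY_expect_cosDiff_mem_Icc_pow_nnBoxShellSum {R : ℕ} (hR : 1 ≤ R) (hL : 2 * R + 2 ≤ L) {K : ℝ}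
    (hK : 0 ≤ K) (a c : TorusSite d L) :
    (torusXY d L).expect K 1 (cosDiff a c) ∈ Set.Icc 0 (nnBoxShellSum K d R ^ (torusDist a c / R)) := by
  rw [(torusXY d L).expect_one_eq_expectJ]
  refine ⟨?_, torusXY_expectJ_cosDiff_le_pow_nnBoxShellSum hR hL hK a c⟩
  rw [(torusXY d L).expectJ_cosDiff_eq_twoPoint]
  exact twoPoint_nonneg ((torusXY d L).pairCoupling_nonneg fun _ => hK) a c

/-- **Uniform bound at distance `≥ n·R`**: if `S_R(K) ≤ 1` and `dist_∞(a, c) ≥ n·R` then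
`⟨cos(θ_a − θ_c)⟩_{K,L} ≤ S_R(K)^n`. [cite: Lieb1980, Theorem 4 and p. 128 (boxes)] -/
theorem torusXY_expectJ_cosDiff_le_pow_of_le_torusDist {R : ℕ} (hR : 1 ≤ R) (hL : 2 * R + 2 ≤ L) {K : ℝ}
    (hK : 0 ≤ K) (hS1 : nnBoxShellSum K d R ≤ 1) {n : ℕ} {a c : TorusSite d L} (hn : n * R ≤ torusDist a c) :
    (torusXY d L).expectJ (fun _ => K) (cosDiff a c) ≤ nnBoxShellSum K d R ^ n := by
  have hS0 : 0 ≤ nnBoxShellSum K d R :=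
    boxShellSum_nonneg (fun u v => mul_nonneg (div_nonneg hK zero_le_two) (nnCoupling_nonneg _ _)) R
  refine (torusXY_expectJ_cosDiff_le_pow_nnBoxShellSum hR hL hK a c).trans ?_
  exact pow_le_pow_of_le_one hS0 hS1 ((Nat.le_div_iff_mul_le hR).2 hn)

end Criterion

end Literature.Probability.LatticeModels
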